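import Literature.AnabelianGeometry.SemiGraphs.BTempQDPairQuotients
import Literature.AnabelianGeometry.SemiGraphs.QuasiTemperoidsCharts
import Literature.AlgebraicGeometry.Frobenioids.QuasiTemperoidConnectedPart
import HarnessLib

/-!
# Semi-graphs of anabelioids, Appendix, proof of Theorem A.4: the quotient functor
# `q : D → T`, `(B, Γ_B) ↦ B/Γ_B`, for the model temperoid `T = B^temp(Π)`

Mochizuki, *Semi-graphs of anabelioids*, Publ. RIMS **42** (2006) 221–322, Appendix, proof of
Theorem A.4, manuscript p. 83 (PRIMS p. 312 l. −6 – p. 313 l. 5)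
[cite: MochizukiSemiAnbd2006, Thm A.4 proof p.83]: "Write `D_i` for the category whose objects are
QD-pairs of `Q_i` and whose morphisms are morphisms of QD-pairs … we obtain a natural functor
`q_i : D_i → T_i` given by the assignment `(B, Γ_B) ↦ B/Γ_B`. Note that this functor maps 1-proper
morphisms of `D_i` to isomorphisms of `T_i`. Moreover, one verifies immediately that this functor
`q_i` is essentially surjective; that `q_i((B, Γ_B))` is connected if and only if `(B, Γ_B)` is
weakly connected; and that every connected object of `T_i` is isomorphic to the image via `q_i` of
a strongly connected QD-pair."

Sub-node A4-q of `plan/L3/SUBDAG-SemiAnbd-Cor311.md`, over the orbit-space construction of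
`BTempQDPairQuotients.lean` (`QDPair.orbitQuotient`, sub-node A3iii), for QD-pairs of the model
temperoid `B^temp(Π)` itself (the category `D` of QD-pairs of `B^temp(Π)`; the QD-pairs of a
`T[A] ⊆ B^temp(Π)` are among these, `QDPair.toBTemp`):

* `QDPair.orbitQuotientMap`, `QDPair.orbitQuotientFunctor` — `q` on morphisms (a morphism of
  QD-pairs descends to the orbit spaces) and as a functor `QDPair (BTemp Π) ⥤ BTemp Π`;
* `QDPair.isIso_orbitQuotientMap_of_isOneProper` — "maps 1-proper morphisms to isomorphisms";
* `QDPair.trivialPair`, `QDPair.isIso_orbitQuotientπ_trivialPair`,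
  `QDPair.orbitQuotientFunctor_essSurj` — "`q_i` is essentially surjective" (`B = q(B, {1})`);
* `QDPair.exists_stronglyConnected_orbitQuotient_iso` — "every connected object of `T_i` is
  isomorphic to the image via `q_i` of a strongly connected QD-pair";
* `QDPair.isConnectedObj_orbitQuotient_iff_of_fact` — "`q_i((B, Γ_B))` is connected iff `(B, Γ_B)`
  is weakly connected", DERIVED for `Π` tempered from the Definition A.3 (iii) bracket taken BY
  NAME (`QuotientConnectedIffWeaklyConnected`, typed in `QuasiTemperoidsQDPairs.lean`, an open
  sub-node of the same sub-DAG; `B^temp(Π)` is a connected quasi-temperoid,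
  `IsConnectedTemperoid.isConnectedQuasiTemperoid`) — so this clause is CONDITIONAL on that named
  statement and says so.

Elementary `Π`-set theory; nothing refers to the IUT corpus; no side is taken on any disputed
claim.
-/

open CategoryTheory CategoryTheory.Limits Topology

namespace Literature.AnabelianGeometry.SemiGraphs

open Literature.AlgebraicGeometry.Frobenioids (IsConnectedObj IsNonemptyObj)
open Literature.AlgebraicGeometry.Frobenioids.QuasiTemperoid (IsConnectedQuasiTemperoid)
open Literature.AlgebraicGeometry.Frobenioids.QuasiTemperoid.BTempConnected (hom_ρ hom_ext_apply
  isIso_of_bijective)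

universe u

variable {G : Type u} [Group G] [TopologicalSpace G]

namespace QDPair

variable [IsTopologicalGroup G]

/-! ### `q` on morphisms and as a functor -/

/-- **`q` on morphisms**: a morphism of QD-pairs `(X₁, Γ₁) → (X₂, Γ₂)` of `B^temp(Π)` descends to
the orbit spaces `X₁/Γ₁ → X₂/Γ₂` (every `γ₁ ∈ Γ₁` lies over some `γ₂ ∈ Γ₂`, Def. A.3 (ii), so
`X₁ → X₂ → X₂/Γ₂` is `Γ₁`-invariant). [cite: MochizukiSemiAnbd2006, Thm A.4 proof p.83] -/
def orbitQuotientMap {P₁ P₂ : QDPair (BTemp G)} (f : P₁ ⟶ P₂) :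
    P₁.orbitQuotient ⟶ P₂.orbitQuotient :=
  P₁.orbitQuotientDesc (f.hom ≫ P₂.orbitQuotientπ) fun γ hγ => by
    obtain ⟨γ', hγ', h⟩ := f.comm γ hγ
    rw [← Category.assoc, ← h, Category.assoc, P₂.aut_comp_orbitQuotientπ hγ']

/-- `π₁ ≫ q(f) = f ≫ π₂`. [cite: MochizukiSemiAnbd2006, Thm A.4 proof p.83] -/
@[simp] theorem orbitQuotientπ_map {P₁ P₂ : QDPair (BTemp G)} (f : P₁ ⟶ P₂) :
    P₁.orbitQuotientπ ≫ orbitQuotientMap f = f.hom ≫ P₂.orbitQuotientπ :=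
  P₁.orbitQuotientπ_desc _ _

/-- `q(f)` on classes: `[x] ↦ [f x]`. [cite: MochizukiSemiAnbd2006, Thm A.4 proof p.83] -/
@[simp] theorem orbitQuotientMap_apply {P₁ P₂ : QDPair (BTemp G)} (f : P₁ ⟶ P₂) (x : P₁.A.obj.V) :
    ((orbitQuotientMap f).hom.hom (P₁.orbitMk x) : P₂.orbitQuotient.obj.V) =
      P₂.orbitMk (f.hom.hom.hom x) := rfl

/-- **The functor `q : D → T`, `(B, Γ_B) ↦ B/Γ_B`** for `T = B^temp(Π)` and `D` its category of
QD-pairs. [cite: MochizukiSemiAnbd2006, Thm A.4 proof p.83] -/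
def orbitQuotientFunctor : QDPair (BTemp G) ⥤ BTemp G where
  obj P := P.orbitQuotient
  map f := orbitQuotientMap f
  map_id P := P.orbitQuotient_hom_ext (by
    rw [orbitQuotientπ_map, Category.comp_id]
    exact Category.id_comp _)
  map_comp f g := by
    apply orbitQuotient_hom_ext
    rw [orbitQuotientπ_map, ← Category.assoc, orbitQuotientπ_map, Category.assoc, orbitQuotientπ_map]
    exact Category.assoc _ _ _

/-- The functor on objects is the orbit space. [cite: MochizukiSemiAnbd2006, Thm A.4 proof p.83] -/
@[simp] theorem orbitQuotientFunctor_obj (P : QDPair (BTemp G)) :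
    (orbitQuotientFunctor (G := G)).obj P = P.orbitQuotient := rfl

/-- The functor on morphisms is `orbitQuotientMap`. [cite: MochizukiSemiAnbd2006, Thm A.4 proof p.83] -/
@[simp] theorem orbitQuotientFunctor_map {P₁ P₂ : QDPair (BTemp G)} (f : P₁ ⟶ P₂) :
    (orbitQuotientFunctor (G := G)).map f = orbitQuotientMap f := rfl

/-! ### 1-proper morphisms go to isomorphisms -/

/-- **"`q_i` maps 1-proper morphisms of `D_i` to isomorphisms of `T_i`"**: if `f : (X₁, Γ₁) → (X₂, Γ₂)`
is 1-proper (every `γ₂` lifts to `Γ₁`, and `X₁ → X₂` forms a quotient of `(X₁, Ker(Γ₁ ↠ Γ₂))`),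
then `X₁/Γ₁ → X₂/Γ₂` is bijective on points, hence an isomorphism of `B^temp(Π)`.
[cite: MochizukiSemiAnbd2006, Thm A.4 proof p.83] -/
theorem isIso_orbitQuotientMap_of_isOneProper {P₁ P₂ : QDPair (BTemp G)} (f : P₁ ⟶ P₂)
    (hf : Hom.IsOneProper f) : IsIso (orbitQuotientMap f) := by
  obtain ⟨-, hlift, hquot⟩ := hf
  -- the quotient `X₁ → X₂` of `(X₁, Stab_{Γ₁}(f))`: surjective with the stabiliser orbits as fibres
  have hsurj := IsQuotient.surjective (P := (⟨P₁.A, Hom.stabilizer f⟩ : QDPair (BTemp G))) hquot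
  have hfib := fun x y => (IsQuotient.apply_eq_iff
    (P := (⟨P₁.A, Hom.stabilizer f⟩ : QDPair (BTemp G))) hquot (x := x) (y := y)).mp
  apply isIso_of_bijective
  constructor
  · intro q q'
    induction q using Quotient.ind with
    | _ x =>
      induction q' using Quotient.ind with
      | _ x' =>
        intro hq
        change P₂.orbitMk (f.hom.hom.hom x) = P₂.orbitMk (f.hom.hom.hom x') at hq
        obtain ⟨γ', hγ', hγ'x⟩ := P₂.orbitMk_eq_iff.mp hq
        obtain ⟨γ, hγ, hγγ'⟩ := hlift γ' hγ'
        -- `f (γ x) = γ' (f x) = f x'`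
        have h1 : (f.hom.hom.hom (γ.hom.hom.hom x) : P₂.A.obj.V) = f.hom.hom.hom x' := by
          rw [← hγ'x]
          exact (congrArg (fun φ : P₁.A ⟶ P₂.A => (φ.hom.hom x : P₂.A.obj.V)) hγγ').symm
        obtain ⟨δ, hδ, hδx⟩ := hfib _ _ h1
        have hδΓ : δ ∈ P₁.Γ := hδ.1
        exact P₁.orbitMk_eq_iff.mpr ⟨δ * γ, P₁.Γ.mul_mem hδΓ hγ, hδx⟩
  · intro q
    induction q using Quotient.ind with
    | _ y =>
      obtain ⟨x, hx⟩ := hsurj y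
      exact ⟨P₁.orbitMk x, by
        change P₂.orbitMk (f.hom.hom.hom x) = P₂.orbitMk y
        exact congrArg P₂.orbitMk hx⟩

/-! ### Essential surjectivity: `B = q(B, {1})` -/

/-- The QD-pair `(B, {1})` (the first functor `Q_i → D_i`, "maps an object `B` of `Q_i` to the
QD-pair `(B, {1})`", p. 85). [cite: MochizukiSemiAnbd2006, Thm A.4 proof p.85] -/
abbrev trivialPair (X : BTemp G) : QDPair (BTemp G) := ⟨X, ⊥⟩

/-- The identity forms a quotient of `(B, {1})`. [cite: MochizukiSemiAnbd2006, Thm A.4 proof p.85] -/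
theorem isQuotient_id_trivialPair (X : BTemp G) : (trivialPair X).IsQuotient (𝟙 X) := by
  refine ((trivialPair X).isQuotient_iff_surjective (𝟙 X)).mpr ⟨?_, fun x => ⟨x, rfl⟩, ?_⟩
  · intro γ hγ
    have hγ1 : γ = 1 := (Subgroup.mem_bot (G := Aut X)).mp hγ
    subst hγ1
    exact Category.id_comp _
  · intro x y hxy
    exact ⟨1, (⊥ : Subgroup (Aut X)).one_mem, hxy⟩

/-- `B → B/{1}` is an isomorphism (the class map for the trivial group is a bijection).
[cite: MochizukiSemiAnbd2006, Thm A.4 proof p.85] -/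
theorem isIso_orbitQuotientπ_trivialPair (X : BTemp G) : IsIso (trivialPair X).orbitQuotientπ := by
  apply isIso_of_bijective
  refine ⟨fun x y hxy => ?_, fun q => ?_⟩
  · obtain ⟨γ, hγ, rfl⟩ := (trivialPair X).orbitMk_eq_iff.mp hxy
    have hγ1 : γ = 1 := (Subgroup.mem_bot (G := Aut X)).mp hγ
    subst hγ1
    rfl
  · obtain ⟨x, rfl⟩ := (trivialPair X).orbitMk_surjective q
    exact ⟨x, rfl⟩

/-- **"`q_i` is essentially surjective."** [cite: MochizukiSemiAnbd2006, Thm A.4 proof p.83] -/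
theorem orbitQuotientFunctor_essSurj : (orbitQuotientFunctor (G := G)).EssSurj where
  mem_essImage X := by
    haveI := isIso_orbitQuotientπ_trivialPair X
    exact ⟨trivialPair X, ⟨(asIso (trivialPair X).orbitQuotientπ).symm⟩⟩

/-- **"Every connected object of `T_i` is isomorphic to the image via `q_i` of a strongly connected
QD-pair"** (namely of `(B, {1})`). [cite: MochizukiSemiAnbd2006, Thm A.4 proof p.83] -/
theorem exists_stronglyConnected_orbitQuotient_iso (X : BTemp G) (hX : IsConnectedObj X) :
    ∃ P : QDPair (BTemp G), P.IsStronglyConnected ∧ Nonempty (P.orbitQuotient ≅ X) := by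
  haveI := isIso_orbitQuotientπ_trivialPair X
  exact ⟨trivialPair X, hX, ⟨(asIso (trivialPair X).orbitQuotientπ).symm⟩⟩

/-! ### Connected iff weakly connected (from the Definition A.3 (iii) bracket, by name) -/

/-- `B^temp(Π)` (for `Π` tempered) is a connected quasi-temperoid (`= B^temp(Π)[Π/Π]`).
[cite: MochizukiSemiAnbd2006, Def A.1(i) p.79] -/
theorem isConnectedQuasiTemperoid_bTemp (hG : IsTempered G) :
    IsConnectedQuasiTemperoid.{u, u + 1, u} (BTemp G) :=
  IsConnectedTemperoid.isConnectedQuasiTemperoid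
    ⟨{ G := G, isTempered := hG, equiv := CategoryTheory.Equivalence.refl }⟩

/-- **"`q_i((B, Γ_B))` is connected if and only if `(B, Γ_B)` is weakly connected"**, for `Π`
tempered, DERIVED from the Definition A.3 (iii) bracket `QuotientConnectedIffWeaklyConnected` taken
BY NAME (an open sub-node of the same sub-DAG): `B^temp(Π)` is a connected quasi-temperoid and
`B → B/Γ_B` forms a quotient there. CONDITIONAL on that named statement.
[cite: MochizukiSemiAnbd2006, Thm A.4 proof p.83] -/
theorem isConnectedObj_orbitQuotient_iff_of_fact (hG : IsTempered G)
    (hA3 : QuotientConnectedIffWeaklyConnected.{u, u, u + 1}) (P : QDPair (BTemp G)) :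
    IsConnectedObj P.orbitQuotient ↔ P.IsWeaklyConnected :=
  hA3 (BTemp G) (isConnectedQuasiTemperoid_bTemp hG) P P.orbitQuotientπ P.isQuotient_orbitQuotientπ

end QDPair

end Literature.AnabelianGeometry.SemiGraphs
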